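import Summits.BirchSwinnertonDyer.BirchSwinnertonDyer.Theorems.SchneiderFreeAdditiveX3ResidualPairIsogenyInvariance
import Summits.BirchSwinnertonDyer.BirchSwinnertonDyer.Theorems.SchneiderFreeAdditiveX3UpperGordCellThreeAnomalousOfPartner
import Summits.BirchSwinnertonDyer.Rank1Residual.X1.GoodLatticeExists
import HarnessLib

/-!
# Route `SchneiderFreeAdditiveX3Upper` (K1 wing) / `SchneiderFreeAdditiveX3` (K1 door), the (G-ord, `e = 2`) cell AT `p = 3`, ANOMALOUS twists:
# the field co-socket and the UPPER half of BSD₃ PER PAIR from [DIV.dvd] + [RH] + [PWL-θ] + a Keller–Yin-normalised member of the PARTNER CLASS —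
# generation 28's displayed hypothesis «`W`'s pair = `V`'s characters» DISCHARGED by the isogeny invariance of the residual pair

Cell `bsd-schneider-ideate`, seat `bsd-schneider-door-c5` (prover, generation 29; assembly layer; `--supports` 19177; FYI wing 20365).
PARTITION: board row B6 ∩ X3 ∩ sst-twist, `r = 1`, (G-ord, `e = 2`) half at `p = 3`, the 1 725 ANOMALOUS pairs of `Rank1Residual.partition` —
ASSEMBLY on top of generation 28's `…UpperGordCellThreeAnomalousOfPartner` (p693359) and this generation's `…ResidualPairIsogenyInvariance`;
types-the-object-of nothing; closes none of B6's cells (BSD NOT advanced).  bears_on: K1-door (19177 r3), K1-wing (20365).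

## What

Generation 28 obtained the WING's field co-socket `AdditiveIMCUpperBDPInputManinAtField W 3 K` for an anomalous pair from [DIV.dvd] + the `μ`-provider
read AT THE PARTNER ([RH] + [PWL-θ] of Keller–Yin 2402.12781, typed by cell `bsd-eis`), but had to DISPLAY: a rational `3`-line `Ψ` of `W` with a
Teichmüller pair `(θa, θb)` and the hypothesis `hab` «`(θa, θb)` is the partner's pair `(θsub, θquot)` in either order», plus a presentation
`W = C₁ • V₁^(−3)`, `V₁ ~ V`.  By `ResidualPairIsogeny.teichmullerPair_eq_or_swap_of_negThree_twist_of_isIsogenous` (the residual pair is a `ℚ`-isogeny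
invariant; the `(−3)`-twist swaps it) ALL of this follows from ONE statement about the class: **«the `(−3)`-twist `W^(−3)` is `ℚ`-isogenous to a
globally minimal `V`, good ordinary and anomalous at `3`, every rational `3`-line of which is ramified at `3`»** (a Keller–Yin-normalised member of the
partner class; certified on 1 725 / 1 725 anomalous census pairs by kit j323864, generation 28 §2c).

* §1 **`additiveIMCUpperBDPInputManinAtField_three_of_RH_of_PWL_of_partnerClass`**: the field co-socket at `p = 3`, `d_K ≠ −3`, for `W` on the cell in
  Keller–Yin 2410.23241's normalisation (`hlat`) ⟸ Kolyvagin ∧ modularity ∧ Hsieh A ∧ LZZ ∧ CHσ ∧ [DIV.dvd] ∧ [RH] ∧ [PWL-θ] ∧ that ONE statement.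
  (p693359 §3 `…_at_partner_of_isIsogenous` with `V₁ := W^(−3)`, `C₁ := D⁻¹` from `(W^(−3))^(−3) = D • W`, `V`'s pair from `Red V 3` — itself from
  `W`'s line transported —, `Ψ`'s pair from `exists_teichmullerPair_of_line`, and `hab` from the invariance.)
* §2 **`missingUpperBoundAt_gordTwo_three_of_printedFacts_of_twistUnitAt_of_partnerClass_…`**: the UPPER half `MissingUpperBoundAt W 3`
  (`ord₃ #Ш(E) ≤ ord₃ #Ш(E)_an`) PER PAIR for every globally minimal `W/ℚ` with `r_an = 1`, `ClassX3 W 3`, `SubGordTwo W 3`, the class statement, and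
  the pair's twist-unit datum — generation 25's `…_odd_of_printedFacts_of_twistUnitAt_of_forall_twist_…` with the NAT co-socket replaced by §1 at the
  good member `W₁ ~ W` of `coChainMemberField_gordTwo_of_coIMCFieldAt_isogenous_of_control` (the class statement passes to `W₁`: `W₁^(−3) ~ W^(−3) ~ V`).
  This is generation 28's «NEXT (i)» (FINDING-door-c5-g28 §2b: «left to a successor»).

INPUT LEDGER, UPPER half per ANOMALOUS pair at `p = 3` (1 725 census pairs): ⟸ `PrintedFacts` ∧ Hsieh 2014 Thm. A ∧ LZZ 2018 ∧ Castella–Hsieh signed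
(PUBLISHED) ∧ [DIV.dvd] (Keller–Yin 2410.23241 Thm 3.3.6 ∘ Prop 3.4.4, the divisibility — PREPRINT) ∧ [RH] `thm122_rubinHida_residualPair_unrSelmer` ∧
[PWL-θ] `prop125_residualPair_unrSelmer_imprimitive` (cell `bsd-eis`, typed without `_OPEN`: Rubin 1991/94, Hida 2010, de Shalit, Pollack–Weston A.2;
anomalous `𝓕_nr` formulation written in arXiv:2402.12781) ∧ per pair {TU datum (7 101 / 7 101, generation 21), KY-normalised anomalous partner-class
member (1 725 / 1 725, kit j323864)}.  BEFORE this file the per-pair upper half existed for the 686 NAT pairs only (generation 25).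

HONEST FRAMING: compositions CONDITIONAL BY NAME on the displayed statements; nothing analytic; the LOWER half for anomalous pairs is NOT here
(Keller–Yin Thm. 1.4.1-shape `λ`-count and the analytic congruence for the anomalous twist remain open); nothing is closed; BSD is proved for no curve;
«closes rung: none».  No definition, no named fact, no `sorry`.
References: [KellerYin2024b] Thm. 3.3.6 ∘ Prop. 3.4.4 ([DIV.dvd]; arXiv:2410.23241 p. 19); [KellerYin2024] Thm. 1.2.2, Prop. 1.2.5 (arXiv:2402.12781v2);
[CastellaGrossiLeeSkinner2022] §1.2; [CastellaHsieh2018] §3.3, Def. 3.7, Prop. 3.8; [Hsieh2014] Thm. A; [LiuZhangZhang2018] Thms. 1.5.1/1.5.3;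
[JetchevSkinnerWan2017] §7.4.1; [SilvermanAEC2009] X.5 Cor. 5.4, Cor. III.4.11; this seat p693359 (generation 28), p675920 (generation 25).
-/

set_option autoImplicit false
set_option linter.dupNamespace false -- the summit namespace `…BirchSwinnertonDyer.BirchSwinnertonDyer.Theorems` (Sub = Summit, D-0017) trips it

noncomputable section

open scoped Classical NumberField

open Field NumberField IsDedekindDomain WeierstrassCurve PowerSeries
  Literature.NumberTheory.EllipticCurves Literature.NumberTheory.EllipticCurves.GreenbergSelmer
  Literature.NumberTheory.GaloisRepresentations Literature.NumberTheory.GaloisCohomology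
  Literature.NumberTheory.EllipticCurves.ModularForms Literature.NumberTheory.EllipticCurves.Rank1Residual
  Literature.NumberTheory.EllipticCurves.Rank1Residual.Typed
  Literature.NumberTheory.EllipticCurves.IwasawaAlgebra
  Literature.NumberTheory.EllipticCurves.KellerYin2024 Literature.NumberTheory.EllipticCurves.CaiShuTian2014
  Summit.BirchSwinnertonDyer.Rank1Residual Summit.BirchSwinnertonDyer.Rank1Residual.Additive
  Summit.BirchSwinnertonDyer.Rank1Residual.X11b
  Summit.BirchSwinnertonDyer.Rank1Residual.X11b.AcSelmer Summit.BirchSwinnertonDyer.Rank1Residual.X11b.Halves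
  Summit.BirchSwinnertonDyer.Rank1Residual.X11b.CongruenceLimit
  Summit.BirchSwinnertonDyer.BirchSwinnertonDyer.Theorems
  Summit.BirchSwinnertonDyer.BirchSwinnertonDyer.Theorems.SchneiderFree
  Summit.BirchSwinnertonDyer.BirchSwinnertonDyer.Theorems.SchneiderFree.Upper
  Summit.BirchSwinnertonDyer.BirchSwinnertonDyer.Theorems.SchneiderFree.KYRead
  Summit.BirchSwinnertonDyer.BirchSwinnertonDyer.Theorems.SchneiderFreeAdditiveX3
  Summit.BirchSwinnertonDyer.BirchSwinnertonDyer.Theorems.SchneiderFreeAdditiveX3.LZZMatch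
  Summit.BirchSwinnertonDyer.BirchSwinnertonDyer.Theorems.SchneiderFreeAdditiveX3.ControlDischarged
  Summit.BirchSwinnertonDyer.BirchSwinnertonDyer.Theorems.SchneiderFreeAdditiveX3.KYBranchOnly
  Summit.BirchSwinnertonDyer.BirchSwinnertonDyer.Theorems.SchneiderFreeAdditiveX3.KYBranchHalves
  Summit.BirchSwinnertonDyer.BirchSwinnertonDyer.Theorems.SchneiderFreeAdditiveX3.KYMuZeroOfPrint
  Summit.BirchSwinnertonDyer.BirchSwinnertonDyer.Theorems.SchneiderFreeAdditiveX3.UpperOfPrint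
  Summit.BirchSwinnertonDyer.BirchSwinnertonDyer.Theorems.SchneiderFreeAdditiveX3.UpperOfPrintDvd
  Summit.BirchSwinnertonDyer.BirchSwinnertonDyer.Theorems.SchneiderFreeAdditiveX3.UpperOfPrintNonAnomalousTwist
  Summit.BirchSwinnertonDyer.BirchSwinnertonDyer.Theorems.SchneiderFreeAdditiveX3.TwistThreeResidualPair
  Summit.BirchSwinnertonDyer.BirchSwinnertonDyer.Theorems.SchneiderFreeAdditiveX3.AnomalousTwistMuZero
  Summit.BirchSwinnertonDyer.BirchSwinnertonDyer.Theorems.SchneiderFreeAdditiveX3.UpperThreeAnomalousOfPartner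
  Summit.BirchSwinnertonDyer.BirchSwinnertonDyer.Theorems.SchneiderFreeAdditiveX3.ResidualPairIsogeny
  Summit.BirchSwinnertonDyer.BirchSwinnertonDyer.Theorems.EisensteinPrimesMuLambda

open Literature.NumberTheory.EllipticCurves.KellerYin2024 (thm122_rubinHida_residualPair_unrSelmer prop125_residualPair_unrSelmer_imprimitive)
open Literature.NumberTheory.EllipticCurves.CastellaGrossiLeeSkinner2022 (prop14_residualCharacterSelmer_finite)

open Summit.BirchSwinnertonDyer.BirchSwinnertonDyer.Theses.SchneiderFreeAdditiveX3Upper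

namespace Summit.BirchSwinnertonDyer.BirchSwinnertonDyer.Theorems.SchneiderFreeAdditiveX3.UpperThreeAnomalousOfPartnerClass

/-! ### §1 The field co-socket at `p = 3` for an anomalous twist from a Keller–Yin-normalised member of the PARTNER CLASS -/

/-- **WING field co-socket `AdditiveIMCUpperBDPInputManinAtField W 3 K` (`d_K ≠ −3`) for an ANOMALOUS twist ⇐ Kolyvagin ∧ modularity ∧ Hsieh 2014 Thm. A ∧
LZZ 2018 ∧ Castella–Hsieh signed ∧ [DIV.dvd] (PREPRINT) ∧ [RH] ∧ [PWL-θ] (cell `bsd-eis`'s typed Keller–Yin 2402.12781 inputs) ∧ ONE statement about the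
class: `W^(−3) ~ V` with `V` globally minimal, good ordinary and anomalous at `3`, all rational `3`-lines of `V` ramified at `3`.**  `W` globally
minimal on the cell (`ClassX3 W 3`, `SubGordTwo W 3`) in Keller–Yin 2410.23241's normalisation (`hlat`).  Generation 28's
`UpperThreeAnomalousOfPartner.additiveIMCUpperBDPInputManinAtField_three_of_RH_of_PWL_at_partner_of_isIsogenous` with: `V₁ := W^(−3)`, `C₁ := D⁻¹`
(`(W^(−3))^(−3) = D • W`); `V`'s Teichmüller pair from `Red V 3` (the line of `W` untwisted onto `W^(−3)`, then reducibility along `W^(−3) ~ V`);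
`W`'s line `Ψ` from `hlat` with its pair (`exists_teichmullerPair_of_line`); and the displayed hypothesis `hab` «`Ψ`'s pair = `V`'s characters,
either order» now a THEOREM (`ResidualPairIsogeny.teichmullerPair_eq_or_swap_of_negThree_twist_of_isIsogenous`).  CONDITIONAL BY NAME on the displayed
statements; nothing asserted about BSD; the crux and the wing stay OPEN.
[cite: KellerYin2024b, Thm. 3.3.6 and Prop. 3.4.4 (arXiv:2410.23241 p. 19) (preprint; hypothesis)]
[cite: KellerYin2024, Thm. 1.2.2 and Prop. 1.2.5 (arXiv:2402.12781v2 TeX L676–683, L780–800)] [cite: CastellaHsieh2018, §3.3, Def. 3.7 and Prop. 3.8]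
[cite: Hsieh2014, Thm. A p. 712 (Doc. Math. 19)] [cite: LiuZhangZhang2018, Thm 1.5.1 and Thm 1.5.3 (Duke Math. J. 167 pp. 748–749)]
[cite: SilvermanAEC2009, X.5 Cor. 5.4, Cor. III.4.11] -/
theorem additiveIMCUpperBDPInputManinAtField_three_of_RH_of_PWL_of_partnerClass
    (hKo : ∀ (N : ℕ) [NeZero N] (W : WeierstrassCurve ℚ) (K : Type) [Field K] [NumberField K],
      Literature.NumberTheory.EllipticCurves.kolyvagin N W K)
    (hPar : nonempty_modularParametrizationData)
    (hA : Hsieh2014.thmA_exists_isHsiehLFunction_unrPeriod_anyLevel)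
    (hL : LiuZhangZhang2018.thm151_thm153_modularCurve_heegnerVector_additive)
    (hdvd : thm336_dvd_branch_OPEN) (hCHσ : castellaHsieh2018_exists_isBranchBDPLFunction_signed)
    (hRH : thm122_rubinHida_residualPair_unrSelmer) (hPWL : prop125_residualPair_unrSelmer_imprimitive)
    {W : WeierstrassCurve ℚ} [W.IsElliptic] [W.IsGloballyMinimal] (hX : ClassX3 W 3) (hSG : Additive.SubGordTwo W 3)
    (hlat : ∃ Φ : AddSubgroup (geomTorsion W ((3 : ℕ) : ℤ)), IsRationalLine W 3 Φ ∧ ¬ LineDecompositionTrivialAt W 3 Φ)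
    {V : WeierstrassCurve ℚ} [V.IsElliptic] [V.IsGloballyMinimal] (hV : (W.quadraticTwist (-3 : ℚ)).IsIsogenous V)
    (hord : GoodOrd V 3) (hanom : (3 : ℤ) ∣ V.frobeniusTrace 3 - 1)
    (hlatV : ∀ Φ : AddSubgroup (geomTorsion V ((3 : ℕ) : ℤ)), IsRationalLine V 3 Φ → ¬ LineUnramifiedAt V 3 Φ)
    (K : Type) [Field K] [NumberField K] (hdK : NumberField.discr K ≠ -3) :
    AdditiveIMCUpperBDPInputManinAtField W 3 K := by
  have hd0 : (-3 : ℚ) ≠ 0 := by norm_num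
  haveI := W.isElliptic_quadraticTwist hd0
  -- the presentation `W = D⁻¹ • (W^(−3))^(−3)`
  obtain ⟨D, hD⟩ := exists_quadraticTwist_quadraticTwist_eq_smul W hd0
  have hC₁ : D⁻¹ • (W.quadraticTwist (-3 : ℚ)).quadraticTwist (-3 : ℚ) = W := by rw [hD, inv_smul_smul]
  -- `W`'s Keller–Yin line and its Teichmüller pair
  obtain ⟨Ψ, hΨ, hΨnt⟩ := hlat
  obtain ⟨θa, θb, hsW, hqW⟩ := EisensteinCharacterInvariantsAtThreeCharacterCutEq.exists_teichmullerPair_of_line W 3 hΨ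
  -- `V[3]` is reducible: `Ψ` untwists onto `W^(−3) ~ V`
  have h1 : (1 : VariableChange ℚ) • W.quadraticTwist (-3 : ℚ) = W.quadraticTwist (-3 : ℚ) := one_smul _ _
  obtain ⟨Ψ₁, hΨ₁, -, -⟩ := exists_isRationalLine_teichmullerPair_swap_of_negThree_twist (1 : VariableChange ℚ) h1 hΨ hsW hqW
  have hredV : Red V 3 :=
    not_hasIrreducibleModPGaloisRep_of_isIsogenous hV (not_hasIrreducibleModPGaloisRep_of_isRationalLine hΨ₁)
  -- `V`'s Teichmüller pair, and `hab` as a theorem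
  obtain ⟨Φ, hΦ, θsub, θquot, hsub, hquot⟩ := exists_teichmullerPair V 3 hredV
  have hab : (θa = θsub ∧ θb = θquot) ∨ (θa = θquot ∧ θb = θsub) :=
    ResidualPairIsogeny.teichmullerPair_eq_or_swap_of_negThree_twist_of_isIsogenous D⁻¹ hC₁ hV hΦ hsub hquot hΨ hsW hqW
  exact additiveIMCUpperBDPInputManinAtField_three_of_RH_of_PWL_at_partner_of_isIsogenous hKo hPar hA hL hdvd hCHσ hRH hPWL hX hSG
    ⟨Ψ, hΨ, hΨnt⟩ D⁻¹ hC₁ hV hord hanom hlatV hΦ hsub hquot hΨ hab hsW hqW K hdK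

/-! ### §2 Per pair: the UPPER half on (G-ord, `e = 2`) at `p = 3` for ANOMALOUS twists -/

/-- **UPPER half per ANOMALOUS pair on the (G-ord, `e = 2`) cell at `p = 3` ⇐ `PrintedFacts` ∧ Hsieh 2014 Thm. A ∧ Liu–Zhang–Zhang 2018 ∧ Castella–Hsieh
signed (PUBLISHED) ∧ [DIV.dvd] (Keller–Yin 2410.23241 Thm 3.3.6 ∘ Prop 3.4.4, the divisibility — PREPRINT) ∧ [RH] ∧ [PWL-θ] (cell `bsd-eis`'s typed
Keller–Yin 2402.12781 Thm. 1.2.2 / Prop. 1.2.5) ∧ the pair's twist-unit datum ∧ a Keller–Yin-normalised anomalous member of the PARTNER CLASS.**  For every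
globally minimal `W/ℚ` with `r_an = 1`, `ClassX3 W 3`, `SubGordTwo W 3`, `W^(−3) ~ V` (`V` globally minimal, `GoodOrd V 3`, `3 ∣ a₃(V) − 1`, every rational
`3`-line of `V` ramified at `3`) and `Upper.TwistUnitFieldOffSliverAt W 3`: `MissingUpperBoundAt W 3` (`ord₃ #Ш(E) ≤ ord₃ #Ш(E)_an`).  Generation 25's
`missingUpperBoundAt_gordTwo_odd_…_of_forall_twist_…` VERBATIM with the co-socket at the good member `W₁ ~ W` := §1 (the class statement passes to
`W₁`: `W₁^(−3) ~ W^(−3) ~ V`).  On the census: 1 725 anomalous (G-ord) pairs at `p = 3`, TU certified on all (generation 21), a normalised anomalous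
partner-class member on all (kit j323864).  CONDITIONAL; closes no item; BSD not advanced.
[cite: KellerYin2024b, Thm. 3.3.6 and Prop. 3.4.4, divisibility clause (arXiv:2410.23241 p. 19) (preprint; hypothesis)]
[cite: KellerYin2024, Thm. 1.2.2 and Prop. 1.2.5 (arXiv:2402.12781v2 TeX L676–683, L780–800)]
[cite: JetchevSkinnerWan2017, §7.4.1 (arXiv:1512.06894 p. 30)] [cite: CastellaHsieh2018, §3.3, Def. 3.7 and Prop. 3.8] [cite: Miller2011LMS, Def. 1.1]
[cite: SilvermanAEC2009, X.5 Cor. 5.4, Cor. III.4.11] -/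
theorem missingUpperBoundAt_gordTwo_three_of_printedFacts_of_twistUnitAt_of_partnerClass_of_hsieh_of_lzz_of_KY_dvd_of_RH_of_PWL_of_castellaHsieh_signed
    (hF : PrintedFacts) (hA : Hsieh2014.thmA_exists_isHsiehLFunction_unrPeriod_anyLevel)
    (hL : LiuZhangZhang2018.thm151_thm153_modularCurve_heegnerVector_additive)
    (hdvd : thm336_dvd_branch_OPEN) (hCHσ : castellaHsieh2018_exists_isBranchBDPLFunction_signed)
    (hRH : thm122_rubinHida_residualPair_unrSelmer) (hPWL : prop125_residualPair_unrSelmer_imprimitive) :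
    ∀ (W : WeierstrassCurve ℚ) [W.IsElliptic] [W.IsGloballyMinimal],
      W.analyticRank = 1 → ClassX3 W 3 → Additive.SubGordTwo W 3 →
      (∃ (V : WeierstrassCurve ℚ) (_ : V.IsElliptic) (_ : V.IsGloballyMinimal),
        (W.quadraticTwist (-3 : ℚ)).IsIsogenous V ∧ GoodOrd V 3 ∧ (3 : ℤ) ∣ V.frobeniusTrace 3 - 1 ∧
          ∀ Φ : AddSubgroup (geomTorsion V ((3 : ℕ) : ℤ)), IsRationalLine V 3 Φ → ¬ LineUnramifiedAt V 3 Φ) →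
      Upper.TwistUnitFieldOffSliverAt W 3 → MissingUpperBoundAt W 3 := by
  obtain ⟨hGZ, hKo, hGZK, hmod, hPar, hCas, hGZ73, -, -, hHP, -, -, -⟩ := hF
  have hCtl := anticycControlAdditiveKF_proof controlFacts_proof.1 controlFacts_proof.2.1 controlFacts_proof.2.2.1
    controlFacts_proof.2.2.2 hKo
  intro W _ _ hr hX hG hcls hTU
  obtain ⟨V, _, _, hV, hord, hanom, hlatV⟩ := hcls
  have hp2 : (3 : ℕ) ≠ 2 := by norm_num
  have hd0 : (-3 : ℚ) ≠ 0 := by norm_num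
  have hpN : 3 ∣ W.conductorNorm ℤ := (W.dvd_conductorNorm_iff_not_hasGoodReductionAtPrime 3).mpr hX.2.1
  refine Upper.missingUpperBoundAt_of_goodMemberCoStepLField_of_twistUnitFieldOffSliver hGZ hKo hGZK hmod hGZ73 hCas hHP W 3 hr hp2 hpN
    (fun K _ _ hK _ hpd hdK ↦ coChainMemberField_gordTwo_of_coIMCFieldAt_isogenous_of_control hKo hPar hCtl W 3 hr hp2 hX hG K hK hpd
      fun W₁ _ _ hiso₁ hX₁ hS₁ hlat₁ ↦ ?_) hTU
  -- the class statement passes to the good member: `W₁^(−3) ~ W^(−3) ~ V`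
  have hV₁ : (W₁.quadraticTwist (-3 : ℚ)).IsIsogenous V := (hiso₁.symm_of_charZero.quadraticTwist hd0).trans' hV
  exact additiveIMCUpperBDPInputManinAtField_three_of_RH_of_PWL_of_partnerClass hKo hPar hA hL hdvd hCHσ hRH hPWL hX₁ hS₁ hlat₁ hV₁ hord hanom
    hlatV K hdK

/-! ### §3 The class statement from ONE anomalous good-ordinary twist model: Ribet's lemma (a tree theorem) normalises the partner -/

/-- **Two `d`-twist models of one curve are `ℚ`-isogenous** (indeed isomorphic): `C • V^(d) = W = C₁ • V₁^(d)` gives `V^(d) ~ V₁^(d)`, twist again and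
untwist (`(X^(d))^(d) ≅ X`).  Generation 25's `forall_twist_of_isIsogenous` argument, isolated. [cite: SilvermanAEC2009, X.5 Cor. 5.4] -/
theorem isIsogenous_of_twist_models {V V₁ W : WeierstrassCurve ℚ} {d : ℚ} (hd : d ≠ 0) (C C₁ : VariableChange ℚ)
    (hC : C • V.quadraticTwist d = W) (hC₁ : C₁ • V₁.quadraticTwist d = W) : V.IsIsogenous V₁ := by
  have h1 : IsIsogenous (V.quadraticTwist d) (V₁.quadraticTwist d) := by
    have hW : IsIsogenous (V.quadraticTwist d) W := by rw [← hC]; exact isIsogenous_smul _ C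
    have hW₁ : IsIsogenous W (V₁.quadraticTwist d) := by rw [← hC₁]; exact isIsogenous_of_smul _ C₁
    exact hW.trans' hW₁
  obtain ⟨D, hD⟩ := exists_quadraticTwist_quadraticTwist_eq_smul V hd
  obtain ⟨D₁, hD₁⟩ := exists_quadraticTwist_quadraticTwist_eq_smul V₁ hd
  have h := h1.quadraticTwist hd
  rw [hD, hD₁] at h
  exact ((isIsogenous_smul V D).trans' h).trans' (isIsogenous_of_smul V₁ D₁)

/-- **The class statement is a THEOREM given one anomalous good-ordinary `(−3)`-twist model.**  If `W` (with `W[3]` reducible) is `C • V₀^(−3)` with `V₀`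
globally minimal, good ordinary and ANOMALOUS at `3`, then `W^(−3)` is `ℚ`-isogenous to a globally minimal `V`, good ordinary and anomalous at `3`, all of
whose rational `3`-lines are ramified at `3`: `V₀[3]` is reducible (the line of `W` untwisted, generation 28's swap), RIBET'S LEMMA — the tree THEOREM
`X1.GoodLatticeExists.ribet_exists_isIsogenous_noUnramifiedLine_holds` (cell `bsd-eis`; Keller–Yin Prop. 1.3.1's normalisation) — gives the good-lattice
member `V ~ V₀`, and good reduction / `a₃` pass along the isogeny (`Additive.hasGoodReductionAtPrime_iff_of_isIsogenous`, Faltings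
`frobeniusTrace_eq_of_isIsogenous`).  So on the anomalous sub-cell the per-pair certificate of kit j323864 is not needed.
[cite: KellerYin2024, Prop. 1.3.1 and §1.4 (arXiv:2402.12781v2 L877–L885, L1077–L1086)] [cite: Ribet1976, Prop. 2.1]
[cite: Faltings1983Endlichkeit, §5 Korollar 2] [cite: SilvermanAEC2009, X.5 Cor. 5.4] -/
theorem exists_partnerClass_of_anomalous_twist_model {W : WeierstrassCurve ℚ} [W.IsElliptic] (hred : Red W 3)
    {V₀ : WeierstrassCurve ℚ} [V₀.IsElliptic] [V₀.IsGloballyMinimal] (C : VariableChange ℚ) (hC : C • V₀.quadraticTwist (-3 : ℚ) = W)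
    (hord₀ : GoodOrd V₀ 3) (hanom₀ : (3 : ℤ) ∣ V₀.frobeniusTrace 3 - 1) :
    ∃ (V : WeierstrassCurve ℚ) (_ : V.IsElliptic) (_ : V.IsGloballyMinimal),
      (W.quadraticTwist (-3 : ℚ)).IsIsogenous V ∧ GoodOrd V 3 ∧ (3 : ℤ) ∣ V.frobeniusTrace 3 - 1 ∧
        ∀ Φ : AddSubgroup (geomTorsion V ((3 : ℕ) : ℤ)), IsRationalLine V 3 Φ → ¬ LineUnramifiedAt V 3 Φ := by
  have hd0 : (-3 : ℚ) ≠ 0 := by norm_num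
  haveI := W.isElliptic_quadraticTwist hd0
  -- `W^(−3) ≅ V₀`
  obtain ⟨C'', hC''⟩ := exists_smul_quadraticTwist_eq_of_smul_quadraticTwist_eq V₀ W hd0 C hC
  have hWV₀ : (W.quadraticTwist (-3 : ℚ)).IsIsogenous V₀ := by rw [← hC'']; exact isIsogenous_smul _ C''
  -- `V₀[3]` is reducible: the line of `W` untwisted
  obtain ⟨Ψ, hΨ, θa, θb, hsW, hqW⟩ := exists_teichmullerPair W 3 hred
  obtain ⟨Ψ₀, hΨ₀, -, -⟩ := exists_isRationalLine_teichmullerPair_swap_of_negThree_twist C'' hC'' hΨ hsW hqW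
  have hred₀ : Red V₀ 3 := not_hasIrreducibleModPGaloisRep_of_isRationalLine hΨ₀
  -- Ribet's lemma (tree theorem): the good-lattice member of the class of `V₀`
  obtain ⟨V, hEV, hminV, hiso, hlatV⟩ :=
    X1.GoodLatticeExists.ribet_exists_isIsogenous_noUnramifiedLine_holds V₀ 3 (by norm_num) hord₀.1 hred₀
  have hgoodV : V.HasGoodReductionAtPrime 3 := (Additive.hasGoodReductionAtPrime_iff_of_isIsogenous hiso 3).mp hord₀.1
  have ha : V₀.frobeniusTrace 3 = V.frobeniusTrace 3 := frobeniusTrace_eq_of_isIsogenous hiso 3 hord₀.1 hgoodV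
  refine ⟨V, hEV, hminV, hWV₀.trans' hiso, ⟨hgoodV, ?_⟩, ?_, hlatV⟩
  · rw [← ha]; exact hord₀.2
  · rw [← ha]; exact hanom₀

/-! ### §4 The whole (G-ord, `e = 2`) cell at `p = 3`: NAT or an anomalous twist model, and the UPPER half per pair from the TU datum alone -/

/-- **Dichotomy on the cell.**  For `W` globally minimal with `ClassX3 W 3`, `SubGordTwo W 3`: EITHER every good-ordinary `(−3)`-twist model of `W` is
non-anomalous (generation 25's clause `NAT(W, 3)`, in its `(−1)^{(p−1)/2}·p` spelling) OR some good-ordinary `(−3)`-twist model is anomalous — a model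
exists (`SchneiderFree.exists_goodOrd_partner_of_subGordTwo_odd`) and any two models are isogenous (§3), hence share `a₃` (Faltings). [cite: Faltings1983Endlichkeit, §5 Korollar 2]
[cite: SilvermanAEC2009, X.5 Cor. 5.4, VII.7.2] -/
theorem forall_twist_not_anomalous_or_exists_anomalous_twist (W : WeierstrassCurve ℚ) [W.IsElliptic] [W.IsGloballyMinimal]
    (hX : ClassX3 W 3) (hSG : Additive.SubGordTwo W 3) :
    (∀ (V : WeierstrassCurve ℚ) [V.IsElliptic] [V.IsGloballyMinimal] (C : VariableChange ℚ),
        GoodOrd V 3 → C • V.quadraticTwist ((-1 : ℚ) ^ ((3 : ℕ) / 2) * ((3 : ℕ) : ℚ)) = W → ¬ (3 : ℤ) ∣ V.frobeniusTrace 3 - 1) ∨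
      ∃ (V : WeierstrassCurve ℚ) (_ : V.IsElliptic) (_ : V.IsGloballyMinimal) (C : VariableChange ℚ),
        GoodOrd V 3 ∧ C • V.quadraticTwist (-3 : ℚ) = W ∧ (3 : ℤ) ∣ V.frobeniusTrace 3 - 1 := by
  have hp2 : (3 : ℕ) ≠ 2 := by norm_num
  have h3 : ((-1 : ℚ) ^ ((3 : ℕ) / 2) * ((3 : ℕ) : ℚ)) = (-3 : ℚ) := by norm_num
  have hd0 : (-3 : ℚ) ≠ 0 := by norm_num
  obtain ⟨V₀, hEV₀, hminV₀, C₀, hC₀, hord₀, -⟩ := exists_goodOrd_partner_of_subGordTwo_odd hp2 W hX hSG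
  rw [h3] at hC₀
  by_cases hanom : (3 : ℤ) ∣ V₀.frobeniusTrace 3 - 1
  · exact Or.inr ⟨V₀, hEV₀, hminV₀, C₀, hord₀, hC₀, hanom⟩
  · refine Or.inl fun V _ _ C hV hC ↦ ?_
    rw [h3] at hC
    have hiso : V.IsIsogenous V₀ := isIsogenous_of_twist_models hd0 C C₀ hC hC₀
    rw [frobeniusTrace_eq_of_isIsogenous hiso 3 hV.1 hord₀.1]
    exact hanom

/-- **UPPER half per pair on the WHOLE (G-ord, `e = 2`) cell at `p = 3` from the twist-unit datum ALONE** ⇐ `PrintedFacts` ∧ Hsieh 2014 Thm. A ∧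
Liu–Zhang–Zhang 2018 ∧ CGLS 2022 Prop. 14 ∧ Castella–Hsieh signed (PUBLISHED) ∧ [DIV.dvd] (Keller–Yin 2410.23241, PREPRINT) ∧ [RH] ∧ [PWL-θ] (cell
`bsd-eis`'s typed Keller–Yin 2402.12781 Thm. 1.2.2 / Prop. 1.2.5).  For every globally minimal `W/ℚ` with `r_an = 1`, `ClassX3 W 3`, `SubGordTwo W 3` and
`Upper.TwistUnitFieldOffSliverAt W 3`: `MissingUpperBoundAt W 3` (`ord₃ #Ш(E) ≤ ord₃ #Ш(E)_an`).  By the dichotomy: on the NAT branch generation 25's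
`missingUpperBoundAt_gordTwo_odd_…_of_forall_twist_…` (CGLS Prop. 14 for `μ`); on the anomalous branch §3 ∘ §2 ([RH] + [PWL-θ] at the Ribet-normalised
partner for `μ`).  On the census (2 411 (G-ord) pairs at `p = 3`, TU certified on all, generation 21) this is the upper half for EVERY pair, with no other
per-pair input.  CONDITIONAL BY NAME on the displayed statements; the LOWER half is not here; closes no item; BSD not advanced.
[cite: CastellaGrossiLeeSkinner2022, §1.2 Prop. 14 (arXiv:2008.02571; Invent. Math. 227 (2022))]
[cite: KellerYin2024b, Thm. 3.3.6 and Prop. 3.4.4, divisibility clause (arXiv:2410.23241 p. 19) (preprint; hypothesis)]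
[cite: KellerYin2024, Thm. 1.2.2, Prop. 1.2.5, Prop. 1.3.1 (arXiv:2402.12781v2)] [cite: Ribet1976, Prop. 2.1]
[cite: JetchevSkinnerWan2017, §7.4.1 (arXiv:1512.06894 p. 30)] [cite: CastellaHsieh2018, §3.3, Def. 3.7 and Prop. 3.8] [cite: Miller2011LMS, Def. 1.1] -/
theorem missingUpperBoundAt_gordTwo_three_of_printedFacts_of_twistUnitAt_of_hsieh_of_lzz_of_KY_dvd_of_prop14_of_RH_of_PWL_of_castellaHsieh_signed
    (hF : PrintedFacts) (hA : Hsieh2014.thmA_exists_isHsiehLFunction_unrPeriod_anyLevel)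
    (hL : LiuZhangZhang2018.thm151_thm153_modularCurve_heegnerVector_additive)
    (hdvd : thm336_dvd_branch_OPEN) (h14 : prop14_residualCharacterSelmer_finite)
    (hCHσ : castellaHsieh2018_exists_isBranchBDPLFunction_signed)
    (hRH : thm122_rubinHida_residualPair_unrSelmer) (hPWL : prop125_residualPair_unrSelmer_imprimitive) :
    ∀ (W : WeierstrassCurve ℚ) [W.IsElliptic] [W.IsGloballyMinimal],
      W.analyticRank = 1 → ClassX3 W 3 → Additive.SubGordTwo W 3 →
      Upper.TwistUnitFieldOffSliverAt W 3 → MissingUpperBoundAt W 3 := by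
  intro W _ _ hr hX hG hTU
  rcases forall_twist_not_anomalous_or_exists_anomalous_twist W hX hG with hNAT | ⟨V₀, _, _, C₀, hord₀, hC₀, hanom₀⟩
  · exact missingUpperBoundAt_gordTwo_odd_of_printedFacts_of_twistUnitAt_of_forall_twist_of_hsieh_of_lzz_of_KY_dvd_of_prop14_of_castellaHsieh_signed
      hF hA hL hdvd h14 hCHσ W 3 (by norm_num) hr hX hG hNAT hTU
  · exact missingUpperBoundAt_gordTwo_three_of_printedFacts_of_twistUnitAt_of_partnerClass_of_hsieh_of_lzz_of_KY_dvd_of_RH_of_PWL_of_castellaHsieh_signed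
      hF hA hL hdvd hCHσ hRH hPWL W hr hX hG (exists_partnerClass_of_anomalous_twist_model hX.1 C₀ hC₀ hord₀ hanom₀) hTU

end Summit.BirchSwinnertonDyer.BirchSwinnertonDyer.Theorems.SchneiderFreeAdditiveX3.UpperThreeAnomalousOfPartnerClass

end
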